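import Literature.Probability.LatticeModels.IsingDisorderLaplacian
import HarnessLib

/-!
# Usable dual connectivity of the plaquettes touching a connected set of free sites

Topic `Literature/Probability/LatticeModels`. A small combinatorial brick of the programme behind
`Literature.Probability.LatticeModels.chi_onePoint_rho`: the hypothesis `hconn` of
`exists_isKCCuts_plus` / `exists_isKCCuts_mesh_plus` (`IsingDisorderLaplacian.lean`) — every
plaquette touching the free sites `Λ` is reached from a base plaquette by a dual walk crossing only
bonds with a free endpoint — follows from connectivity of `Λ` through lattice bonds: the four
plaquettes around a free site are usably connected around it (each step crosses a bond at that
site), and lattice-adjacent free sites share a plaquette. (Chelkak–Hongler–Izyurov 2015, §2.1: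
discrete domains are connected unions of faces.) Everything proved; no named facts.

## References

* D. Chelkak, C. Hongler, K. Izyurov, Ann. of Math. 181 (2015) = arXiv:1202.2838, §2.1 —
  `ChelkakHonglerIzyurovAnnals2015`.
-/

noncomputable section

open MeasureTheory Finset

namespace Literature.Probability.LatticeModels

/-! ## Usable dual connectivity of the plaquettes touching a connected set of free sites -/

section Connectivity

open SimpleGraph

/-- **One usable step around a free site**: from the plaquette `faceAt v k` to `faceAt v (k + 3)`
across the bond `{v, v + e_k}`, which touches `Λ` at `v`. [folklore] -/
theorem exists_usableWalk_faceAt_add_three {Λ : Finset (Site 2)} {v : Site 2} (hv : v ∈ Λ) (k : Fin 4) :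
    ∃ W : (zdGraph 2).Walk (faceAt v k) (faceAt v (k + 3)), UsableWalk Λ W := by
  refine ⟨Walk.cons (zdGraph_adj_faceAt_faceAt_add_three v k) Walk.nil, ?_⟩
  intro d hd
  rw [Walk.darts_cons, Walk.darts_nil, List.mem_singleton] at hd
  subst hd
  refine ⟨v, hv, ?_⟩
  show v ∈ plaqBond (faceAt v k) (faceAt v (k + 3))
  rw [plaqBond_faceAt, cSrc]
  exact Sym2.mem_mk_left _ _

/-- **All four plaquettes around a free site are usably connected**. [folklore] -/
theorem exists_usableWalk_faceAt_faceAt {Λ : Finset (Site 2)} {v : Site 2} (hv : v ∈ Λ) (j k : Fin 4) :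
    ∃ W : (zdGraph 2).Walk (faceAt v j) (faceAt v k), UsableWalk Λ W := by
  have h3 : ∀ j : Fin 4, ∃ W : (zdGraph 2).Walk (faceAt v j) (faceAt v (j + 3)), UsableWalk Λ W :=
    fun j => exists_usableWalk_faceAt_add_three hv j
  have h2 : ∀ j : Fin 4, ∃ W : (zdGraph 2).Walk (faceAt v j) (faceAt v (j + 2)), UsableWalk Λ W := by
    intro j
    obtain ⟨W₁, h₁⟩ := h3 j
    obtain ⟨W₂, h₂⟩ := h3 (j + 3)
    refine ⟨W₁.append (W₂.copy rfl ?_), h₁.append fun d hd => h₂ d (by rwa [Walk.darts_copy] at hd)⟩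
    rw [add_assoc, show (3 : Fin 4) + 3 = 2 from rfl]
  have h1 : ∀ j : Fin 4, ∃ W : (zdGraph 2).Walk (faceAt v j) (faceAt v (j + 1)), UsableWalk Λ W := by
    intro j
    obtain ⟨W₁, h₁⟩ := h2 j
    obtain ⟨W₂, h₂⟩ := h3 (j + 2)
    refine ⟨W₁.append (W₂.copy rfl ?_), h₁.append fun d hd => h₂ d (by rwa [Walk.darts_copy] at hd)⟩
    rw [add_assoc, show (2 : Fin 4) + 3 = 1 from rfl]
  have hk : k = j + (k - j) := (add_sub_cancel j k).symm
  generalize k - j = d at hk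
  subst hk
  fin_cases d
  · exact ⟨Walk.nil.copy rfl (by simp), fun d hd => by simp [Walk.darts_copy] at hd⟩
  · exact h1 j
  · exact h2 j
  · exact h3 j

/-- **Usable dual connectivity from connectivity of the free sites**: if the free sites `Λ` are
connected through lattice bonds (as an induced subgraph of `ℤ²`), then any two plaquettes touching
`Λ` are joined by a dual walk crossing only bonds with a free endpoint. (The plaquettes around one
free site are usably connected around it, and adjacent free sites share a plaquette.) This is the
hypothesis `hconn` of `exists_isKCCuts_plus`. [cite: ChelkakHonglerIzyurovAnnals2015, §2.1] -/
theorem exists_usableWalk_of_reachable {Λ : Finset (Site 2)} {x y : Site 2} (hx : x ∈ Λ)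
    (W : (zdGraph 2).Walk x y) (hW : ∀ z ∈ W.support, z ∈ Λ) (j k : Fin 4) :
    ∃ W' : (zdGraph 2).Walk (faceAt x j) (faceAt y k), UsableWalk Λ W' := by
  induction W generalizing j with
  | nil => exact exists_usableWalk_faceAt_faceAt hx j k
  | @cons u w y hadj W ih =>
    have hw : w ∈ Λ := hW w (by simp)
    obtain ⟨i, rfl⟩ := exists_eq_add_cornerUnit hadj
    -- around `u` to the shared plaquette `faceAt u i = faceAt (u + e_i) (i + 1)`, then on from `w`
    obtain ⟨W₁, h₁⟩ := exists_usableWalk_faceAt_faceAt hx j i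
    obtain ⟨W₂, h₂⟩ := ih hw (fun z hz => hW z (by simp [hz])) (i + 1)
    refine ⟨W₁.append (W₂.copy ?_ rfl), h₁.append fun d hd => h₂ d (by rwa [Walk.darts_copy] at hd)⟩
    exact faceAt_add_unit_succ u i

/-- **Corollary** (the form consumed by `exists_isKCCuts_plus`): if `Λ` induces a preconnected
subgraph of `ℤ²` and `p₀` touches `Λ`, every plaquette touching `Λ` is reached from `p₀` by a usable
dual walk. [cite: ChelkakHonglerIzyurovAnnals2015, §2.1] -/
theorem usable_connectivity_of_preconnected {Λ : Finset (Site 2)}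
    (hΛ : ((zdGraph 2).induce (↑Λ : Set (Site 2))).Preconnected) {p₀ : Site 2} (hp₀ : p₀ ∈ touchPlaquettes Λ) :
    ∀ p ∈ touchPlaquettes Λ, ∃ W : (zdGraph 2).Walk p₀ p, UsableWalk Λ W := by
  intro p hp
  obtain ⟨x, hx, j, rfl⟩ := mem_touchPlaquettes.1 hp₀
  obtain ⟨y, hy, k, rfl⟩ := mem_touchPlaquettes.1 hp
  obtain ⟨Wi⟩ := hΛ ⟨x, hx⟩ ⟨y, hy⟩
  -- push the induced walk down to `ℤ²`; its support stays in `Λ`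
  refine exists_usableWalk_of_reachable hx (Wi.map (Embedding.induce (↑Λ : Set (Site 2))).toHom) ?_ j k
  intro z hz
  erw [Walk.support_map, List.mem_map] at hz
  obtain ⟨z', -, rfl⟩ := hz
  exact z'.2

end Connectivity

end Literature.Probability.LatticeModels
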